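import Mathlib
import Summits.ValiantsHypothesis.ValiantsHypothesis.Theorems.ProofCarryingSymmetryRestorationQPESatEMul

/-!
# Route ProofCarryingSymmetry — crux `RestorationQP`, line `registered`: the e-saturation is sound

Support file for the crux item `stmt-ValiantsHypothesis-10343` (lead c5, rung S3^(1)-inv, stub
`esat_eval`).  The e-saturation `ACStability.esat d` of `…ESatDefs.lean` (smart sums `sadd`, peeled
smart products `emul d a b = epeel d (smul a b)`) never changes the polynomial a formula computes:
peeling at the root replaces `k` fitted copies of the pattern `pat = patF ⊎ {s}` (the pure factors
of `p = cnorm P` and `s = cnorm (Q + R)`) together with the constant `cP ^ k` by `k` copies of the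
expansion `sig = cnorm (P·Q + P·R)`, and `sig` computes `p · s = C cP · Π pat`.

* `eval_prodL`, `oevalM_olist` — left combs compute products; `eval_eq_prod_mset` — every formula is
  the product of (the polynomials of) its root factor classes and its root constant;
* `DistData.eval_sig`, `DistData.C_cP_mul_prod_pat`, `DistData.eval_sig_eq_pat` — the value of the
  expansion and of the pattern of a ground distributivity instance;
* `eval_epeel`, `eval_emul`, `eval_esat` (generic instance: `cP ≠ 0`) and the registered statement
  `esat_eval`.

Everything here is elementary and proved; no named facts.
-/

-- single-problem summit: `Summit.ValiantsHypothesis.ValiantsHypothesis.…` is the namespace by design (D-0017)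
set_option linter.dupNamespace false

noncomputable section

open scoped Classical

namespace Summit.ValiantsHypothesis.ValiantsHypothesis.Theorems

namespace ACStability

open Literature.Computability.AlgebraicComplexity ACClass

universe u v

variable {𝔽 : Type u} {X : Type v}

section Semiring

variable [CommSemiring 𝔽]

/-! ### Products of lists of formulas and of multisets of classes -/

/-- A left comb computes the product of its entries. [folklore] -/
theorem eval_prodL (u : PIFormula 𝔽 X) (us : List (PIFormula 𝔽 X)) :
    (prodL u us).eval = ((u :: us).map PIFormula.eval).prod := by
  induction us generalizing u with
  | nil => simp
  | cons w ws ih =>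
    rw [prodL_cons, ih]
    simp only [List.map_cons, List.prod_cons, PIFormula.eval_mul, mul_assoc]

/-- The optional left comb of a list computes the product of the list (`1` for `[]`). [folklore] -/
theorem oevalM_olist (l : List (PIFormula 𝔽 X)) : oevalM (olist l) = (l.map PIFormula.eval).prod := by
  cases l with
  | nil => simp [oevalM]
  | cons u us =>
    rw [olist_cons]
    exact eval_prodL u us

/-- The product of the polynomials of the classes of a list of formulas is the product of the
polynomials of the formulas. [folklore] -/
theorem prod_map_eval_coe (l : List (PIFormula 𝔽 X)) :
    (((l.map mk : List (ACClass 𝔽 X)) : Multiset (ACClass 𝔽 X)).map ACClass.eval).prod =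
      (l.map PIFormula.eval).prod := by
  rw [Multiset.map_coe, Multiset.prod_coe, List.map_map]
  rfl

/-- The root factor classes compute the pure part. [folklore] -/
theorem prod_map_eval_mset (x : PIFormula 𝔽 X) :
    ((mset x).map ACClass.eval).prod = oevalM (msplit x).1 := by
  rw [mset_def, prod_map_eval_coe, margs_def]
  cases (msplit x).1 with
  | none => simp [oevalM]
  | some m =>
    rw [omulArgs_some]
    exact (eval_eq_prod_mulArgs m).symm

/-- **Every formula is the product of its root factor classes and its root constant.** [folklore] -/
theorem eval_eq_prod_mset (x : PIFormula 𝔽 X) :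
    x.eval = ((mset x).map ACClass.eval).prod * MvPolynomial.C (mcst x) := by
  rw [prod_map_eval_mset, mcst_def]
  exact eval_eq_msplit x

/-! ### The value of the expansion and of the pattern -/

namespace DistData

variable (d : DistData 𝔽 X)

/-- `s` computes `q + r`. [folklore] -/
theorem eval_s : d.s.eval = d.q.eval + d.r.eval := by
  rw [DistData.s, eval_sadd]

/-- **The expansion computes `p · s`.** [folklore] -/
theorem eval_sig : d.sig.eval = d.p.eval * d.s.eval := by
  rw [DistData.sig, eval_sadd, eval_smul, eval_smul, eval_s, mul_add]

/-- The pure factors of `p` compute its pure part. [folklore] -/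
theorem prod_map_eval_patF : (d.patF.map PIFormula.eval).prod = oevalM (msplit d.p).1 := by
  rw [DistData.patF, ← prod_map_eval_mset, mset_def, prod_map_eval_coe]

/-- The value of the pattern: the pure part of `p` times `s`. [folklore] -/
theorem prod_map_eval_pat : (d.pat.map ACClass.eval).prod = oevalM (msplit d.p).1 * d.s.eval := by
  rw [DistData.pat, prod_map_eval_coe, List.map_append, List.prod_append, prod_map_eval_patF]
  simp only [List.map_cons, List.map_nil, List.prod_cons, List.prod_nil, mul_one]

/-- **The value of the pattern**, without inverses: `C cP · Π pat = p · s`. [folklore] -/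
theorem C_cP_mul_prod_pat :
    MvPolynomial.C d.cP * (d.pat.map ACClass.eval).prod = d.p.eval * d.s.eval := by
  rw [prod_map_eval_pat, eval_eq_msplit d.p, DistData.cP, mcst_def]
  ring

/-- The expansion computes `C cP` times the value of the pattern. [folklore] -/
theorem eval_sig_eq_pat : d.sig.eval = MvPolynomial.C d.cP * (d.pat.map ACClass.eval).prod := by
  rw [C_cP_mul_prod_pat, eval_sig]

end DistData

end Semiring

/-! ### Peeling, the peeled product and the saturation are sound -/

section Field

variable [Field 𝔽] {d : DistData 𝔽 X}

/-- The ring arithmetic of one peeling step: with `s = C₁ · P` and `C₁ · C₂ = 1`,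
`A · s ^ k · (c · C₂ ^ k) = A · P ^ k · c`. [folklore] -/
theorem peel_arith_aux {R : Type*} [CommSemiring R] {s C₁ C₂ : R} (A P c : R) (k : ℕ)
    (hs : s = C₁ * P) (h : C₁ * C₂ = 1) : A * s ^ k * (c * C₂ ^ k) = A * P ^ k * c := by
  subst hs
  calc A * (C₁ * P) ^ k * (c * C₂ ^ k) = A * P ^ k * c * (C₁ * C₂) ^ k := by ring
    _ = A * P ^ k * c := by rw [h, one_pow, mul_one]

/-- **Replacing `k` fitted copies of the pattern among the root factors by `k` copies of the
expansion and dividing the root constant by `cP ^ k` preserves the value** (generic instance).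
[folklore] -/
theorem eval_peel_aux (hg : d.Generic) (x : PIFormula 𝔽 X) {k : ℕ} (hle : k • d.pat ≤ mset x) :
    (mmk (olist (removeBy (margs x) (k • d.pat) ++ List.replicate k d.sig))
        (mcst x * d.cP⁻¹ ^ k)).eval = x.eval := by
  rw [eval_mmk, oevalM_olist, List.map_append, List.prod_append, List.map_replicate,
    List.prod_replicate, ← prod_map_eval_coe (removeBy (margs x) (k • d.pat)),
    coe_map_mk_removeBy (margs x) (by simpa only [mset_def] using hle), ← mset_def x,
    eval_eq_prod_mset x, MvPolynomial.C_mul, MvPolynomial.C_pow]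
  conv_rhs => rw [← Multiset.sub_add_cancel hle, Multiset.map_add, Multiset.map_nsmul,
    Multiset.prod_add, Multiset.prod_nsmul]
  exact peel_arith_aux _ _ _ k d.eval_sig_eq_pat
    (by rw [← MvPolynomial.C_mul, mul_inv_cancel₀ hg.cP_ne_zero, MvPolynomial.C_1])

/-- **Peeling preserves the computed polynomial** (generic instance). [folklore] -/
theorem eval_epeel (hg : d.Generic) (x : PIFormula 𝔽 X) : (epeel d x).eval = x.eval := by
  by_cases hk : kmax (mset x) d.pat = 0
  · rw [epeel_of_kmax_eq_zero d hk]
  · rw [epeel_of_kmax_ne_zero d hk]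
    exact eval_peel_aux hg x (nsmul_kmax_le _ _)

/-- **The peeled smart product computes the product** (generic instance). [folklore] -/
theorem eval_emul (hg : d.Generic) (a b : PIFormula 𝔽 X) : (emul d a b).eval = a.eval * b.eval := by
  rw [emul, eval_epeel hg, eval_smul]

/-- **The e-saturation preserves the computed polynomial** (generic instance). [folklore] -/
theorem eval_esat (hg : d.Generic) (F : PIFormula 𝔽 X) : (esat d F).eval = F.eval := by
  induction F with
  | var x => rfl
  | const c => rfl
  | add F G ihF ihG => rw [esat_add, eval_sadd, ihF, ihG, PIFormula.eval_add]
  | mul F G ihF ihG => rw [esat_mul, eval_emul hg, ihF, ihG, PIFormula.eval_mul]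

end Field

end ACStability

open Literature.Computability.AlgebraicComplexity in
/-- **The e-saturation is sound** (registered helper of crux `RestorationQP`, line `registered`,
rung S3^(1)-inv): for a generic ground distributivity instance `d`, the e-saturated normal form
`esat d F` computes the same polynomial as `F` — smart sums and smart products are sound, and
peeling `k` copies of the pattern with the constant `cP ^ k` into `k` copies of the expansion
`sig` is sound because `sig` computes `p · s = C cP · Π pat`. [folklore] -/
theorem esat_eval : ∀ {𝔽 : Type} [Field 𝔽] {X : Type} (d : ACStability.DistData 𝔽 X), d.Generic → ∀ F : PIFormula 𝔽 X, (ACStability.esat d F).eval = F.eval :=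
  fun _ hg F => ACStability.eval_esat hg F

end Summit.ValiantsHypothesis.ValiantsHypothesis.Theorems

end
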